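import Summits.BirchSwinnertonDyer.BirchSwinnertonDyer.Theorems.ResidualThetaTransportAtTwoCompactLayerRankBound
import Summits.BirchSwinnertonDyer.BirchSwinnertonDyer.Theorems.ResidualThetaTransportAtTwoUniversalNormMittagLeffler
import Summits.BirchSwinnertonDyer.BirchSwinnertonDyer.Theorems.ThetaPartnerAtTwoSignedTransportAtTwoImprimitiveCount
import Literature.NumberTheory.EllipticCurves.AnticyclotomicSignedCompactSelmer
import Literature.NumberTheory.EllipticCurves.TwoVariableAnticyclotomicControl
import Literature.NumberTheory.EllipticCurves.LambdaAdicSelmerDataCoresProofs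
import Literature.NumberTheory.EllipticCurves.PeriodIndexCorestrictionLocal
import HarnessLib

/-!
# The `Λ`-adic road to SURJ⁺@2 (item 23110): the level groups PULLED BACK from a `γ`-stable subgroup `A ≤ H¹(ℚ_∞, E[p^∞])`
# along `θ_{n,k} : H¹(ℚ_n, E[p^k]) → H¹(ℚ_∞, E[p^∞])` satisfy every hypothesis of the Mittag-Leffler engine — injectivity of
# `θ_{n,k}` when `E(ℚ_∞)[p^∞] = 0`, `p_*`/`Cor`/`conj_γ`-compatibility, finiteness — and the MITTAG-LEFFLER VANISHING for them

Routes `ResidualThetaTransportAtTwo` (RTT, crux r201 `ResidualLambdaFormulaNegDiscAtTwo`, stmt-BirchSwinnertonDyer-23110) /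
`ThetaPartnerAtTwo` (K1 `stub_surj2`). Seat `prover-bsd-wall-tp2-p2x-w2` g14; `--supports stmt-BirchSwinnertonDyer-23110`.
THEOREMS ONLY (no definition, no named fact, no `sorry`); closes nothing.

WHY. The engine `exists_transition_eq_zero` (p654128) + the rank bound `le_of_linearIndependent_of_reduceH1Pk_mem` (p655219)
reduce «some transition `C_{j,j} → C_{n₀,k₀}` is zero» to properties of the level groups `C n k`. THIS FILE verifies them for
`C n k := θ_{n,k}⁻¹(A)`, `θ_{n,k} = AcSigned.toInfty W p κ n k` (restriction to `ℚ_∞` composed with `E[p^k] ↪ E[p^∞]`, the map of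
Hatley–Lei–Vigni's Remark 3.1 already in the tree), for ANY subgroup `A ≤ H¹(ℚ_∞, E[p^∞])` stable under `conj_γ` with `A[p]` finite:

* `toInfty_injective_of_forall_fixed_eq_zero` — `θ_{n,k}` is injective when `E[p^∞]` has no non-zero point fixed by `Gal(ℚ̄/ℚ_∞)`
  (kernel class `[φ]` with `φ|_{ℚ_∞} = ∂b`, `b ∈ E[p^∞]`; `p^k b` is fixed, hence `0`, so `b ∈ E[p^k]` and `res_{ℚ_∞}[φ] = 0`
  already with `E[p^k]`-coefficients; inflation–restriction `resOfLe_injective_of_forall_fixed_eq_zero`);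
* `toInfty_reduceTorsionH1` — `θ_{n,k} ∘ p_* = p • θ_{n,k+1}` (on cocycles);
* `toInfty_layerCores_eq_sum` — `θ_{n,k} ∘ Cor_{ℚ_{n+1}/ℚ_n} = Σ_{i<p} conj_{γ^{pⁿ i}} ∘ θ_{n+1,k}` (`res ∘ cor = norm`,
  tree `ZpExtension.resLe_coresLe_layer_succ_eq_sum_conjMap`);
* `finite_comap_toInfty` — `θ_{n,k}⁻¹(A)` is finite: it embeds in `A[p^k]` (`#A[p^k] ≤ #A[p]^k`);
* `exists_transition_eq_zero_comap_toInfty` — THE MITTAG-LEFFLER VANISHING FOR PULLED-BACK LEVEL GROUPS: `κ` cyclotomic with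
  topological generator `γ`, `E(ℚ_∞)[p^∞] = 0`, `A ≤ H¹(ℚ_∞, E[p^∞])` `γ`-stable with `A[p]` finite: for every `(n₀, k₀)` and every
  transition system `T` to `(n₀, k₀)` there is `j ≥ n₀, k₀` such that `T j j x = 0` for every `x ∈ H¹(ℚ_j, E[p^j])` with
  `θ_{j,j} x ∈ A`;
* `exists_transition_eq_zero_signedSelmerInfty_of_goodSS` — `p = 2`, `E` globally minimal with good supersingular reduction at `2`,
  `A = Sel⁺(E/ℚ_∞)` (Kobayashi, `signedSelmerInfty E κ 1`) of a finitely generated torsion signed dual datum with `μ = 0`: the same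
  conclusion — every class of `H¹(ℚ_j, E[2^j])` whose image over `ℚ_∞` is `+`-Selmer is killed by the transition to `(n₀, k₀)`,
  for `j ≫ 0`. This is the Mittag-Leffler input of the layer Poitou–Tate step of road Λ at EVERY Mordell–Weil rank (no
  `Finite Sel`, no weak Leopoldt); the Poitou–Tate step itself (self-duality of the `+` condition at `2`, `res`/`cor` adjointness of the
  local Tate pairings) is NOT done here.

HONEST FRAMING: closes nothing; 23110 is NOT proved; BSD is not proved by any of this.
References: [GreenbergLNM1716] §3 Lemma 3.1 (inflation–restriction kernel `H¹(Γ_n, E(F_∞)[p^∞])`), §4 p. 109; [HatleyLeiVigni2022]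
Remark 3.1; [Rubin2000] App. B §B.3; [GreenbergVatsal2000] §2 Prop. (2.1); [NeukirchSchmidtWingberg2008] I §5 (1.5.6)–(1.5.7).
-/

set_option autoImplicit false
-- D-0017: single-problem summit, so `Summit.BirchSwinnertonDyer.BirchSwinnertonDyer.…` repeats a namespace BY DESIGN.
set_option linter.dupNamespace false

noncomputable section

open scoped AddSubgroup
open Field CategoryTheory
open Literature.NumberTheory.GaloisRepresentations
open Literature.NumberTheory.EllipticCurves Literature.NumberTheory.EllipticCurves.Kato2004
open Literature.NumberTheory.EllipticCurves.Kato2004.EulerSystemValues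
open Literature.NumberTheory.EllipticCurves.AcSigned (toInfty toInfty_conjH1 toInfty_resOfLe geomTorsion_zpow_le_geomPrimaryTorsion)
open WeierstrassCurve (geomTorsion geomPoints)

namespace Summit.BirchSwinnertonDyer.BirchSwinnertonDyer.Theorems.ResidualThetaLayer.TowerVanishing

variable {p : ℕ} [Fact p.Prime] (W : WeierstrassCurve ℚ) (κ : ZpExtension ℚ p)

/-! ## §1 The maps `θ_{n,k} : H¹(ℚ_n, E[p^k]) → H¹(ℚ_∞, E[p^∞])` -/

/-- **`θ_{n,k}` is injective when `E(ℚ_∞)[p^∞] = 0`.** If no non-zero point of `E[p^∞]` is fixed by `Gal(ℚ̄/ℚ_∞)`, the map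
`θ_{n,k} : H¹(ℚ_n, E[p^k]) → H¹(ℚ_∞, E[p^∞])` (restriction + `E[p^k] ↪ E[p^∞]`) is injective: a kernel class `[φ]` restricts over
`ℚ_∞` to `∂b` with `b ∈ E[p^∞]`; then `p^k b` is `Gal(ℚ̄/ℚ_∞)`-fixed, so `p^k b = 0`, `b ∈ E[p^k]`, `res_{ℚ_∞}[φ] = 0` with
`E[p^k]`-coefficients, and inflation–restriction (`E[p^k]^{Gal(ℚ̄/ℚ_∞)} = 0`) gives `[φ] = 0`.
[cite: GreenbergLNM1716, §3 Lemma 3.1 (PDF p. 86)] -/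
theorem toInfty_injective_of_forall_fixed_eq_zero (n k : ℕ)
    (hfix : ∀ c : W.geomPrimaryTorsion p, (∀ σ ∈ κ.kerSubgroup, σ • c = c) → c = 0) :
    Function.Injective (toInfty W p κ n k) := by
  classical
  refine (injective_iff_map_eq_zero _).mpr fun x hx ↦ ?_
  obtain ⟨φ, rfl⟩ := oneCocycleClass_surjective _ x
  rw [toInfty, resH1Hom_oneCocycleClass, oneCocycleClass_eq_zero_iff] at hx
  obtain ⟨b, hb⟩ := hx
  set incl : geomTorsion W ((p : ℤ) ^ k) →+ W.geomPrimaryTorsion p :=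
    AddSubgroup.inclusion (geomTorsion_zpow_le_geomPrimaryTorsion W p k) with hincl
  have hb' : ∀ σ : κ.kerSubgroup,
      incl (φ.1 (subgroupInclusion (κ.kerSubgroup_le_layerSubgroup n) σ)) = σ • b - b := fun σ ↦ hb σ
  -- `p^k • b` is fixed by `Gal(ℚ̄/ℚ_∞)`, hence zero
  have hval : ∀ σ : κ.kerSubgroup, p ^ k • (σ • b - b) = 0 := fun σ ↦ by
    rw [← hb' σ, ← map_nsmul]
    have h0 : p ^ k • φ.1 (subgroupInclusion (κ.kerSubgroup_le_layerSubgroup n) σ) = 0 :=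
      Subtype.ext (by
        rw [AddSubgroupClass.coe_nsmul, ZeroMemClass.coe_zero, ← natCast_zsmul, Nat.cast_pow]
        exact (W.mem_geomTorsion_iff _ _).1 (φ.1 _).2)
    rw [h0, map_zero]
  have hadm : ∀ σ ∈ κ.kerSubgroup, σ • (p ^ k • b) = p ^ k • b := fun σ hσ ↦ by
    have h1 := hval ⟨σ, hσ⟩
    rw [smul_sub, sub_eq_zero] at h1
    rw [smul_comm]
    exact h1
  have hpb : p ^ k • b = 0 := hfix _ hadm
  -- so `b ∈ E[p^k]`
  have hbk : (b : geomPoints W) ∈ geomTorsion W ((p : ℤ) ^ k) := by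
    rw [W.mem_geomTorsion_iff, ← Nat.cast_pow, natCast_zsmul]
    have := congrArg (fun c : W.geomPrimaryTorsion p ↦ (c : geomPoints W)) hpb
    simpa using this
  set b' : geomTorsion W ((p : ℤ) ^ k) := ⟨b, hbk⟩ with hb'def
  have hib : incl b' = b := Subtype.ext rfl
  -- the restriction of `[φ]` to `ℚ_∞` vanishes already with `E[p^k]`-coefficients
  have hres : resOfLe (geomTorsion W ((p : ℤ) ^ k)) (κ.kerSubgroup_le_layerSubgroup n)
      (oneCocycleClass _ φ) = 0 := by
    rw [CocycleCriteria.resOfLe_oneCocycleClass_eq_zero_iff]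
    refine ⟨b', fun σ ↦ ?_⟩
    apply AddSubgroup.inclusion_injective (geomTorsion_zpow_le_geomPrimaryTorsion W p k)
    change incl (φ.1 (subgroupInclusion (κ.kerSubgroup_le_layerSubgroup n) σ)) = incl (σ • b' - b')
    rw [hb' σ, map_sub, hib]
    rfl
  -- inflation–restriction
  haveI : κ.kerSubgroup.Normal := by unfold ZpExtension.kerSubgroup; infer_instance
  have hinj := resOfLe_injective_of_forall_fixed_eq_zero (M := geomTorsion W ((p : ℤ) ^ k))
    (κ.kerSubgroup_le_layerSubgroup n)
    (fun m hm ↦ by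
      apply AddSubgroup.inclusion_injective (geomTorsion_zpow_le_geomPrimaryTorsion W p k)
      rw [map_zero]
      exact hfix _ fun σ hσ ↦ by
        have := congrArg incl (hm σ hσ)
        exact this)
  exact (injective_iff_map_eq_zero _).mp hinj _ hres

/-- **`θ_{n,k} ∘ p_* = p • θ_{n,k+1}`**: the coefficient maps `E[p^{k+1}] —p→ E[p^k] ↪ E[p^∞]` and `p • (E[p^{k+1}] ↪ E[p^∞])`
agree. [cite: HatleyLeiVigni2022, Remark 3.1] [cite: PerrinRiou1987BSMF, §0 p. 401] -/
theorem toInfty_reduceTorsionH1 (n k : ℕ) (x : W.torsionH1Over ((p : ℤ) ^ (k + 1)) (κ.layerSubgroup n)) :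
    toInfty W p κ n k (W.reduceTorsionH1 p k (κ.layerSubgroup n) x) = p • toInfty W p κ n (k + 1) x := by
  obtain ⟨φ, rfl⟩ := oneCocycleClass_surjective _ x
  rw [WeierstrassCurve.reduceTorsionH1, resH1Hom_oneCocycleClass, toInfty, resH1Hom_oneCocycleClass, toInfty,
    resH1Hom_oneCocycleClass, ← oneCocycleClassₗ_apply, ← oneCocycleClassₗ_apply, ← map_nsmul]
  congr 1

/-- **`θ_{n,k}⁻¹(A)` is finite** when `θ_{n,k}` is injective and `A[p]` is finite: it embeds in `A[p^k]` (`p^k` kills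
`H¹(ℚ_n, E[p^k])`), and `#A[p^k] ≤ #A[p]^k`. [cite: GreenbergLNM1716, §1 p. 60] -/
theorem finite_comap_toInfty (n k : ℕ) (A : AddSubgroup (W.subgroupH1 p κ.kerSubgroup)) [Finite ((↥A)[(p : ℤ)])]
    (hinj : Function.Injective (toInfty W p κ n k)) :
    ((A.comap (toInfty W p κ n k) : AddSubgroup (W.torsionH1Over ((p : ℤ) ^ k) (κ.layerSubgroup n))) :
      Set (W.torsionH1Over ((p : ℤ) ^ k) (κ.layerSubgroup n))).Finite := by
  haveI : Finite ((↥A)[((p : ℤ) ^ k)]) := finite_torsionBy_pow p k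
  let f : A.comap (toInfty W p κ n k) → (↥A)[((p : ℤ) ^ k)] := fun x ↦
    ⟨⟨toInfty W p κ n k x, AddSubgroup.mem_comap.mp x.2⟩, by
      change ((p : ℤ) ^ k) • (⟨toInfty W p κ n k x, AddSubgroup.mem_comap.mp x.2⟩ : ↥A) = 0
      apply Subtype.ext
      change ((p : ℤ) ^ k) • toInfty W p κ n k x = 0
      have h : ((p ^ k : ℕ) : ℤ) • toInfty W p κ n k x = 0 := by
        rw [natCast_zsmul, ← map_nsmul, WeierstrassCurve.LambdaAdicSelmerDataExists.pow_nsmul_eq_zero W p _ k,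
          map_zero]
      rw [Nat.cast_pow] at h
      exact h⟩
  have hf : Function.Injective f := fun x y h ↦ Subtype.ext (hinj (by
    have h' := congrArg (fun z : (↥A)[((p : ℤ) ^ k)] ↦ ((z : ↥A) : W.subgroupH1 p κ.kerSubgroup)) h
    exact h'))
  exact Set.finite_coe_iff.mp (Finite.of_injective f hf)

variable {γ : absoluteGaloisGroup ℚ}

/-- Powers of `γ` preserve a `conj_γ`-stable subgroup of `H¹(ℚ_∞, E[p^∞])` (`conj_1 = id`, `conj_{στ} = conj_σ ∘ conj_τ`).
[cite: NeukirchSchmidtWingberg2008, I §5] -/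
theorem conjH1_pow_mem {A : AddSubgroup (W.subgroupH1 p κ.kerSubgroup)}
    (hAγ : ∀ s ∈ A, W.conjH1 p κ.kerSubgroup γ s ∈ A) (N : ℕ) {s : W.subgroupH1 p κ.kerSubgroup} (hs : s ∈ A) :
    W.conjH1 p κ.kerSubgroup (γ ^ N) s ∈ A := by
  induction N generalizing s with
  | zero =>
    rw [pow_zero]
    have h1 := Literature.NumberTheory.EllipticCurves.conjH1_one_holds κ.kerSubgroup (W.geomPrimaryTorsion p)
    rw [WeierstrassCurve.conjH1, h1, AddMonoidHom.id_apply]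
    exact hs
  | succ N ih =>
    rw [pow_succ, WeierstrassCurve.conjH1,
      Literature.NumberTheory.EllipticCurves.conjH1_mul_holds κ.kerSubgroup (W.geomPrimaryTorsion p) (γ ^ N) γ,
      AddMonoidHom.comp_apply]
    exact ih (hAγ s hs)

/-- **`θ_{n,k} ∘ Cor = N ∘ θ_{n+1,k}`**: for a topological generator `γ`,
`θ_{n,k} (Cor_{ℚ_{n+1}/ℚ_n} x) = Σ_{i<p} conj_{γ^{pⁿ i}} (θ_{n+1,k} x)` (`res_{ℚ_n → ℚ_{n+1}} ∘ Cor = Σ_{i<p} conj_{γ^{pⁿ i}}`,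
tree `ZpExtension.resLe_coresLe_layer_succ_eq_sum_conjMap`, and `θ` commutes with restriction and conjugation).
[cite: NeukirchSchmidtWingberg2008, I §5 (1.5.6)–(1.5.7)] -/
theorem toInfty_layerCores_eq_sum (hγ : κ.IsTopGenerator γ) (n k : ℕ)
    (x : W.torsionH1Over ((p : ℤ) ^ k) (κ.layerSubgroup (n + 1))) :
    toInfty W p κ n k (layerCores (W.torsionGaloisModule ((p : ℤ) ^ k)) κ n x) =
      ∑ i ∈ Finset.range p, W.conjH1 p κ.kerSubgroup (γ ^ (p ^ n * i)) (toInfty W p κ (n + 1) k x) := by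
  classical
  haveI : (κ.layerSubgroup (n + 1)).FiniteIndex :=
    finiteIndex_of_isOpen_of_compactSpace _ (κ.isOpen_layerSubgroup (n + 1))
  letI : Fintype (κ.layerSubgroup n ⧸ (κ.layerSubgroup (n + 1)).subgroupOf (κ.layerSubgroup n)) := Fintype.ofFinite _
  have hcores : layerCores (W.torsionGaloisModule ((p : ℤ) ^ k)) κ n x =
      coresLe (W.torsionGaloisModule ((p : ℤ) ^ k)).toTopRep (κ.layerSubgroup_antitone (Nat.le_succ n))
        (κ.isOpen_layerSubgroup (n + 1)) x := by
    unfold layerCores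
    convert rfl
  have key : resOfLe (geomTorsion W ((p : ℤ) ^ k)) (κ.layerSubgroup_antitone (Nat.le_succ n))
        (layerCores (W.torsionGaloisModule ((p : ℤ) ^ k)) κ n x) =
      ∑ i ∈ Finset.range p, conjH1 (κ.layerSubgroup (n + 1)) (geomTorsion W ((p : ℤ) ^ k)) (γ ^ (p ^ n * i)) x := by
    rw [hcores, WeierstrassCurve.resOfLe_geomTorsion_eq_resLe,
      κ.resLe_coresLe_layer_succ_eq_sum_conjMap _ hγ n]
    rfl
  rw [← toInfty_resOfLe W p κ (Nat.le_succ n) k, key, map_sum]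
  exact Finset.sum_congr rfl fun i _ ↦ toInfty_conjH1 W p κ (n + 1) k _ x

/-! ## §2 The Mittag-Leffler vanishing for pulled-back level groups -/

/-- **Mittag-Leffler vanishing for level groups pulled back from a `γ`-stable `A ≤ H¹(ℚ_∞, E[p^∞])`.** Let `κ` be the cyclotomic
`ℤ_p`-extension of `ℚ` with topological generator `γ`, assume `E(ℚ_∞)[p^∞] = 0` (no non-zero `Gal(ℚ̄/ℚ_∞)`-fixed point of `E[p^∞]`) and that
the layers `H¹(ℚ_n, T_pE)` have no `p`-torsion, and let `A ≤ H¹(ℚ_∞, E[p^∞])` be stable under `conj_γ` with `A[p]` finite. Then for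
every `(n₀, k₀)` and every transition system `T` to `(n₀, k₀)` (`T n₀ k₀ = id`; `T n (k+1) = T n k ∘ p_*`, `T (n+1) k = T n k ∘ Cor`
on the quadrant) there is `j ≥ n₀, k₀` with `T j j x = 0` for every `x ∈ H¹(ℚ_j, E[p^j])` whose image `θ_{j,j} x` lies in `A`.
The engine `exists_transition_eq_zero` for `C n k = θ_{n,k}⁻¹(A)` (stable by §1, finite by `finite_comap_toInfty`), with the rank
bound `le_of_linearIndependent_of_reduceH1Pk_mem` (`B = #A[p]`, `θ_{n,k}` injective by §1).
[cite: GreenbergVatsal2000, §2 Prop. (2.1)] [cite: GreenbergLNM1716, §3 Lemma 3.1] [cite: Rubin2000, App. B §B.3] -/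
theorem exists_transition_eq_zero_comap_toInfty [W.IsElliptic] [ContinuousSMul ℤ_[p] (W.tateModule p)]
    (hκ : κ.IsCyclotomic) (hγ : κ.IsTopGenerator γ)
    (hfix : ∀ c : W.geomPrimaryTorsion p, (∀ σ ∈ κ.kerSubgroup, σ • c = c) → c = 0)
    (htf : ∀ (n k : ℕ) (y : H1 (tateRep W p) (κ.layerSubgroup n)), ((p : ℤ_[p]) ^ k) • y = 0 → y = 0)
    (A : AddSubgroup (W.subgroupH1 p κ.kerSubgroup)) (hAγ : ∀ s ∈ A, W.conjH1 p κ.kerSubgroup γ s ∈ A)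
    [Finite ((↥A)[(p : ℤ)])] (n₀ k₀ : ℕ)
    (T : ∀ n k : ℕ, W.torsionH1Over ((p : ℤ) ^ k) (κ.layerSubgroup n) →
      W.torsionH1Over ((p : ℤ) ^ k₀) (κ.layerSubgroup n₀))
    (hT0 : ∀ x, T n₀ k₀ x = x)
    (hTk : ∀ (n k : ℕ) (x : W.torsionH1Over ((p : ℤ) ^ (k + 1)) (κ.layerSubgroup n)), n₀ ≤ n → k₀ ≤ k →
      T n (k + 1) x = T n k (W.reduceTorsionH1 p k (κ.layerSubgroup n) x))
    (hTn : ∀ (n k : ℕ) (x : W.torsionH1Over ((p : ℤ) ^ k) (κ.layerSubgroup (n + 1))), n₀ ≤ n → k₀ ≤ k →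
      T (n + 1) k x = T n k (layerCores (W.torsionGaloisModule ((p : ℤ) ^ k)) κ n x)) :
    ∃ j : ℕ, n₀ ≤ j ∧ k₀ ≤ j ∧
      ∀ x : W.torsionH1Over ((p : ℤ) ^ j) (κ.layerSubgroup j), toInfty W p κ j j x ∈ A → T j j x = 0 := by
  classical
  have hP : p.Prime := Fact.out
  -- the pulled-back level groups
  let C : ∀ n k : ℕ, AddSubgroup (W.torsionH1Over ((p : ℤ) ^ k) (κ.layerSubgroup n)) := fun n k ↦
    A.comap (toInfty W p κ n k)
  have hCmem : ∀ (n k : ℕ) (x : W.torsionH1Over ((p : ℤ) ^ k) (κ.layerSubgroup n)),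
      x ∈ C n k ↔ toInfty W p κ n k x ∈ A := fun n k x ↦ Iff.rfl
  have hinj : ∀ n k, Function.Injective (toInfty W p κ n k) := fun n k ↦
    toInfty_injective_of_forall_fixed_eq_zero W κ n k hfix
  have hCγ : ∀ (n k : ℕ) (x : W.torsionH1Over ((p : ℤ) ^ k) (κ.layerSubgroup n)), x ∈ C n k →
      conjH1 (κ.layerSubgroup n) (geomTorsion W ((p : ℤ) ^ k)) γ x ∈ C n k := fun n k x hx ↦ by
    rw [hCmem, toInfty_conjH1]
    exact hAγ _ ((hCmem n k x).mp hx)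
  have hCfin : ∀ n k, (C n k : Set (W.torsionH1Over ((p : ℤ) ^ k) (κ.layerSubgroup n))).Finite := fun n k ↦
    finite_comap_toInfty W κ n k A (hinj n k)
  have hCk : ∀ (n k : ℕ) (x : W.torsionH1Over ((p : ℤ) ^ (k + 1)) (κ.layerSubgroup n)), x ∈ C n (k + 1) →
      W.reduceTorsionH1 p k (κ.layerSubgroup n) x ∈ C n k := fun n k x hx ↦ by
    rw [hCmem, toInfty_reduceTorsionH1]
    exact A.nsmul_mem ((hCmem _ _ x).mp hx) _
  have hCn : ∀ (n k : ℕ) (x : W.torsionH1Over ((p : ℤ) ^ k) (κ.layerSubgroup (n + 1))), x ∈ C (n + 1) k →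
      layerCores (W.torsionGaloisModule ((p : ℤ) ^ k)) κ n x ∈ C n k := fun n k x hx ↦ by
    refine (hCmem n k _).mpr ?_
    rw [toInfty_layerCores_eq_sum W κ hγ]
    exact A.sum_mem fun i _ ↦ conjH1_pow_mem W κ hAγ _ ((hCmem _ _ x).mp hx)
  -- the rank bound with `B = #A[p]`
  have hd : Nat.card ((↥A)[(p : ℤ)]) ≤ p ^ Nat.card ((↥A)[(p : ℤ)]) := (Nat.lt_pow_self hP.one_lt).le
  have hB : ∀ (n m : ℕ) (v : Fin m → H1 (tateRep W p) (κ.layerSubgroup n)),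
      (∀ i k, reduceH1Pk W p k (κ.layerSubgroup n) (v i) ∈ C n k) → LinearIndependent ℤ_[p] v →
      m ≤ Nat.card ((↥A)[(p : ℤ)]) := fun n m v hvC hv ↦
    le_of_linearIndependent_of_reduceH1Pk_mem (κ.layerSubgroup n) (htf n)
      (fun k ↦ (toInfty W p κ n k : H1 (W.torsionGaloisModule ((p : ℤ) ^ k)) (κ.layerSubgroup n) →+
        W.subgroupH1 p κ.kerSubgroup)) (hinj n) A _ hd v hv (fun i k ↦ (hCmem _ _ _).mp (hvC i k))
  obtain ⟨j, hj₁, hj₂, hj⟩ :=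
    exists_transition_eq_zero hκ hγ C hCγ hCfin hCk hCn htf _ hB n₀ k₀ T hT0 hTk hTn
  exact ⟨j, hj₁, hj₂, fun x hx ↦ hj x ((hCmem j j x).mpr hx)⟩

/-- **Mittag-Leffler vanishing for Kobayashi's `+` Selmer tower at `p = 2`, every rank.** Let `E/ℚ` be globally minimal with good
supersingular reduction at `2`, `κ` the cyclotomic `ℤ₂`-extension with topological generator `γ`, and `D` a `+` signed Selmer dual
datum with `X⁺` finitely generated `Λ`-torsion and `μ = 0` (so `Sel⁺(E/ℚ_∞)[2]` is finite, `finite_torsionBy_signedSelmerInfty`; the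
habitat gives `E(ℚ_∞)[2^∞] = 0`, `fixedPoints_kerSubgroup_eq_bot_of_goodSS`, hence torsion-free layers and injective `θ_{n,k}`). Then
for every `(n₀, k₀)` and every transition system `T` to `(n₀, k₀)` there is `j ≥ n₀, k₀` such that `T j j` kills EVERY class
`x ∈ H¹(ℚ_j, E[2^j])` whose image `θ_{j,j} x ∈ H¹(ℚ_∞, E[2^∞])` lies in `Sel⁺(E/ℚ_∞)` — in particular every finite-level `+` Selmer
class mapping into `Sel⁺(E/ℚ_∞)`. This is the Mittag-Leffler input of the layer Poitou–Tate step of the `Λ`-adic road to SURJ⁺@2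
(item 23110) — obtained with NO finiteness of `Sel(E/ℚ)` and no weak Leopoldt; the Poitou–Tate step is not done here.
[cite: GreenbergVatsal2000, §2 Prop. (2.1)] [cite: Kobayashi2003, Def. 1.1] [cite: GreenbergLNM1716, §3 Lemma 3.1, §4 p. 109] -/
theorem exists_transition_eq_zero_signedSelmerInfty_of_goodSS {E : WeierstrassCurve ℚ} [E.IsElliptic] [E.IsGloballyMinimal]
    [ContinuousSMul ℤ_[2] (E.tateModule 2)] (hss : Rank1Residual.GoodSS E 2)
    {κ : ZpExtension ℚ 2} {γ : absoluteGaloisGroup ℚ} (hκ : κ.IsCyclotomic) (hγ : κ.IsTopGenerator γ)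
    (D : Kobayashi2003.SignedSelmerDualData E κ γ 1) [Module.Finite (IwasawaAlgebra 2) D.X]
    (hT : Module.IsTorsion (IwasawaAlgebra 2) D.X) (hμ : D.mu = 0) (n₀ k₀ : ℕ)
    (T : ∀ n k : ℕ, E.torsionH1Over ((2 : ℤ) ^ k) (κ.layerSubgroup n) →
      E.torsionH1Over ((2 : ℤ) ^ k₀) (κ.layerSubgroup n₀))
    (hT0 : ∀ x, T n₀ k₀ x = x)
    (hTk : ∀ (n k : ℕ) (x : E.torsionH1Over ((2 : ℤ) ^ (k + 1)) (κ.layerSubgroup n)), n₀ ≤ n → k₀ ≤ k →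
      T n (k + 1) x = T n k (E.reduceTorsionH1 2 k (κ.layerSubgroup n) x))
    (hTn : ∀ (n k : ℕ) (x : E.torsionH1Over ((2 : ℤ) ^ k) (κ.layerSubgroup (n + 1))), n₀ ≤ n → k₀ ≤ k →
      T (n + 1) k x = T n k (layerCores (E.torsionGaloisModule ((2 : ℤ) ^ k)) κ n x)) :
    ∃ j : ℕ, n₀ ≤ j ∧ k₀ ≤ j ∧ ∀ x : E.torsionH1Over ((2 : ℤ) ^ j) (κ.layerSubgroup j),
      toInfty E 2 κ j j x ∈ Kobayashi2003.signedSelmerInfty E κ 1 → T j j x = 0 := by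
  haveI := SignedTransportAtTwo.finite_torsionBy_signedSelmerInfty E κ γ 1 D hT hμ
  have hbot := SignedTransportAtTwo.fixedPoints_kerSubgroup_eq_bot_of_goodSS E hss κ
  have hfix : ∀ c : E.geomPrimaryTorsion 2, (∀ σ ∈ κ.kerSubgroup, σ • c = c) → c = 0 := fun c hc ↦ by
    have hmem : c ∈ FixedPoints.addSubgroup κ.kerSubgroup (↥(E.geomPrimaryTorsion 2)) := by
      rw [FixedPoints.mem_addSubgroup]
      intro τ
      rw [Subgroup.mk_smul]
      exact hc τ τ.2
    rw [hbot, AddSubgroup.mem_bot] at hmem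
    exact hmem
  exact exists_transition_eq_zero_comap_toInfty E κ hκ hγ hfix
    (fun n k y hy ↦ layerH1_eq_zero_of_pow_smul_eq_zero_of_goodSS hss κ n k y hy)
    (Kobayashi2003.signedSelmerInfty E κ 1) (fun s hs ↦ Kobayashi2003.conjH1_mem_signedSelmerInfty E κ 1 γ hs)
    n₀ k₀ T hT0 hTk hTn

end Summit.BirchSwinnertonDyer.BirchSwinnertonDyer.Theorems.ResidualThetaLayer.TowerVanishing

end
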